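import Summits.ValiantsHypothesis.ValiantsHypothesis.Theorems.LacunarySymmetroidMatrixDescartesCensusTropicalKLaw

/-!
# Route `KPlusLogSqLaw`, crux `TropicalB` — the marker identity (engine of every phase register)

HONEST FRAMING.  Helper file for the crux `Summit.ValiantsHypothesis.ValiantsHypothesis.Theses.KPlusLogSqLaw.TropicalB`
(ledger item `stmt-ValiantsHypothesis-19771`; cell `pub-symmetroid`, seat `val-sym-trop-p2`, 2026-08-26).  Nothing here
proves the registered stub `stub_tropFat`; nothing asserts `TropicalB`, `KPlusLogSqLaw`, `MatrixDescartes` or anything about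
`VP ≠ VNP`.

WHAT IS HERE.  The one arithmetic identity behind every known PERMUTATION REGISTER of a dominant chain (the cell's
SHIFT-THREE family `…TropicalShiftThree`, whose `sum_redistribute` is the case `π = ρ = 1` with the cell's constants):

* `sum_val_sub_eq_mul_card` — **marker identity**: for all bijections `π ρ σ` of `Fin m`,
  `Σ_b ((π (σ b) − ρ b : Fin m) : ℕ) = m · #{b | π (σ b) < ρ b}`,
  where the subtraction is the cyclic one of `Fin m`.  Reading: a CLASS MARKER "entries `(a, b)` with `π a < ρ b` carry an
  extra exponent `c·m`" gives the term of a permutation `σ` the extra slope `c·m·#{b | π (σ b) < ρ b}`, i.e. — by the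
  identity — a per-entry slope CREDIT `c·((π a − ρ b) mod m)` at every entry `(a, b)`, permutation-independently.  With
  `π = ρ = 1` the credit is `c · shift`, which together with a convex penalty in the shift is what makes the `m` rotations the
  dominant permutations of SHIFT-THREE (one "phase" register).  The general form prices the obvious variants (anti-diagonal
  markers `ρ = reversal`, relabelled rows) for the cell's kill list: `J` independent markers cost `K = 2^J` classes.
* `sum_val_sub_eq_mul_card_int` — the same in `ℤ`, the currency of `tropWeight`.
* `sum_val_sub_self_eq_mul_card` — the case `π = ρ = 1`: `Σ_b ((σ b − b : Fin m) : ℕ) = m · #{b | σ b < b}`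
  (sum of cyclic shifts = `m ×` number of wrapping columns), for every permutation `σ`.

References: folklore (the identity is the integrality of the winding number of a permutation read cyclically); used implicitly
in the SHIFT-THREE blueprint (conjb-2 g3, ONBOARD §3.5 step (2)) and in this seat's register census
`HOME/val-sym-trop-p2/REGISTERS.md` (R5/R6).
-/

set_option linter.dupNamespace false
set_option autoImplicit false

namespace Summit.ValiantsHypothesis.ValiantsHypothesis.Theorems.KPlusLogSqLaw

open scoped BigOperators
open Finset

/-- In `Fin m`, the value of the cyclic difference plus the subtrahend is the minuend plus `m` times the wrap indicator.
[folklore] -/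
theorem val_sub_add_val_eq {m : ℕ} (x y : Fin m) :
    ((x - y : Fin m) : ℕ) + (y : ℕ) = (x : ℕ) + m * (if x < y then 1 else 0) := by
  by_cases h : x < y
  · rw [if_pos h, Fin.coe_sub_iff_lt.mpr h]
    have := y.isLt
    omega
  · rw [if_neg h, Fin.coe_sub_iff_le.mpr (not_lt.mp h)]
    have := Fin.le_def.mp (not_lt.mp h)
    omega

/-- **Marker identity.**  For all bijections `π ρ σ` of `Fin m`: the sum over the columns `b` of the cyclic differences
`π (σ b) − ρ b ∈ Fin m` equals `m` times the number of columns with `π (σ b) < ρ b`.  (Both `b ↦ π (σ b)` and `ρ` are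
bijections, so `Σ_b π (σ b) = Σ_b ρ b`; what remains of `Σ_b (π (σ b) − ρ b)` is `m` per wrapping column.) [folklore] -/
theorem sum_val_sub_eq_mul_card {m : ℕ} (π ρ σ : Equiv.Perm (Fin m)) :
    ∑ b, ((π (σ b) - ρ b : Fin m) : ℕ) = m * (univ.filter fun b => π (σ b) < ρ b).card := by
  -- add `Σ_b ρ b` to both sides
  have h1 : ∑ b, (((π (σ b) - ρ b : Fin m) : ℕ) + (ρ b : ℕ)) =
      ∑ b, ((π (σ b) : ℕ) + m * (if π (σ b) < ρ b then 1 else 0)) :=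
    sum_congr rfl fun b _ => val_sub_add_val_eq _ _
  rw [sum_add_distrib, sum_add_distrib, ← mul_sum] at h1
  -- the two plain sums agree: both are `Σ_a a` over `Fin m`
  have h2 : ∑ b, (ρ b : ℕ) = ∑ b, (π (σ b) : ℕ) := by
    rw [Equiv.sum_comp ρ (fun a : Fin m => (a : ℕ))]
    exact (Equiv.sum_comp (σ.trans π) (fun a : Fin m => (a : ℕ))).symm
  rw [h2] at h1
  -- the indicator sum is the cardinality of the filter
  have h3 : ∑ b, (if π (σ b) < ρ b then 1 else 0) = (univ.filter fun b => π (σ b) < ρ b).card := by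
    rw [card_filter]
  rw [h3] at h1
  omega

/-- The marker identity in `ℤ` (the currency of `tropWeight`). [folklore] -/
theorem sum_val_sub_eq_mul_card_int {m : ℕ} (π ρ σ : Equiv.Perm (Fin m)) :
    ∑ b, (((π (σ b) - ρ b : Fin m) : ℕ) : ℤ) = (m : ℤ) * ((univ.filter fun b => π (σ b) < ρ b).card : ℕ) := by
  have h := sum_val_sub_eq_mul_card π ρ σ
  exact_mod_cast h

/-- **Sum of cyclic shifts = `m ×` number of wraps** (the case `π = ρ = 1`): for every permutation `σ` of `Fin m`,
`Σ_b ((σ b − b : Fin m) : ℕ) = m · #{b | σ b < b}`.  This is the KEY IDENTITY of the SHIFT-THREE blueprint: the wrap-class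
marker hands every entry a slope credit proportional to its cyclic shift. [folklore] -/
theorem sum_val_sub_self_eq_mul_card {m : ℕ} (σ : Equiv.Perm (Fin m)) :
    ∑ b, ((σ b - b : Fin m) : ℕ) = m * (univ.filter fun b => σ b < b).card := by
  simpa using sum_val_sub_eq_mul_card 1 1 σ

end Summit.ValiantsHypothesis.ValiantsHypothesis.Theorems.KPlusLogSqLaw
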